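import Summits.Ventures.GridStability.Models.WSCC9FaultOnTrigEnclosure
import Mathlib.Analysis.Real.Pi.Bounds

/-!
# SwingTubeTrig — rational RANGE enclosures of `sin` and `cos` over an interval `[lo, hi] ⊆ [−3, 3]` (part 1 of the GENERIC n-machine kernel tube integrator)

Venture GRIDFUSION (LADDER-GRIDFUSION G1-cct / G2 next-wave lever «fault-on tubes for any classical model by one decide»; seat
gridfusion-model-1 g6).  The WSCC9 bus-7 integrator (`WSCC9FaultOnTubeLegs*`) bounds its two couplings by monotonicity on
`[0, 7/5]`; a general `n`-machine fault-on field `Σ_{j≠i} (C_ij sin(δ_i − δ_j) + D_ij cos(δ_i − δ_j))` needs the RANGE of `sin` / `cos` over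
an arbitrary difference interval `d ∈ [lo, hi]`, possibly containing `0` or `±π/2`.  This file: pointwise bounds at a rational of either sign
(`sinPtLo x ≤ sin x ≤ sinPtHi x`, from `WSCC9.FaultOnLeg.sinLo/sinHi` and oddness; `cosLo/cosHi` are already two-sided), and RANGE bounds
on `[lo, hi] ⊆ [−3, 3]`: `sinRLo lo hi ≤ sin x ≤ sinRHi lo hi` (endpoint minimum unless `−π/2` may lie inside — test `lo < −157/100 ∧
−79/50 < hi` — then `−1`; `sin` is monotone on `[−π/2, π/2]` and on `[π/2, π]` via `sin (π − x) = sin x`), `cosRLo lo hi ≤ cos x ≤ cosRHi lo hi`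
(`cos x = cos |x|` decreasing in `|x|` on `[0, π]`; upper bound `1` when `0 ∈ [lo, hi]`), the SIGN-FREE product enclosure
`min (c l) (c u) ≤ c s ≤ max (c l) (c u)` for `s ∈ [l, u]`, and the MONOTONICITY-AWARE enclosure `termLo/termHi` of one coupling term
`C sin d + D cos d` over `[lo, hi]` (derivative test `derivLo ≥ 0` / `derivHi ≤ 0` by interval arithmetic ⇒ endpoint values; else naive) — the
generic form of the «joint» bound `f_mono/g_mono` of the WSCC9 file.  Every bound is a rational function of rational inputs ⇒ `decide`-able checks.
`π` enters only through `Real.pi_gt_d2` / `Real.pi_lt_d2` (`3.14 < π < 3.15`).  No model sentence here.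
[cite: Moore1979, §3.3 (natural interval extension, monotone pieces), §8.1]
-/

noncomputable section

open Real Set

namespace Summit.Ventures.GridStability.Models

namespace SwingTube

open WSCC9.FaultOnLeg (sinLo sinHi cosLo cosHi sinLo_le le_sinHi cosLo_le le_cosHi)

/-! ### §1 Pointwise bounds at a rational of either sign -/

/-- Lower bound of `sin x` at a rational `x` of either sign: `S₃(x)` for `x ≥ 0`, `−S₂(−x)` for `x < 0`. -/
def sinPtLo (x : ℚ) : ℚ := if 0 ≤ x then sinLo x else -sinHi (-x)

/-- Upper bound of `sin x` at a rational `x` of either sign (`= −sinPtLo (−x)` up to the case split). -/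
def sinPtHi (x : ℚ) : ℚ := if 0 ≤ x then sinHi x else -sinLo (-x)

/-- `sinPtLo x ≤ sin x`. [folklore] -/
theorem sinPtLo_le (x : ℚ) : ((sinPtLo x : ℚ) : ℝ) ≤ Real.sin x := by
  unfold sinPtLo
  split_ifs with h
  · exact sinLo_le h
  · have h' : 0 ≤ -x := by linarith
    have := le_sinHi h'
    push_cast at this ⊢
    rw [Real.sin_neg] at this
    linarith

/-- `sin x ≤ sinPtHi x`. [folklore] -/
theorem le_sinPtHi (x : ℚ) : Real.sin x ≤ ((sinPtHi x : ℚ) : ℝ) := by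
  unfold sinPtHi
  split_ifs with h
  · exact le_sinHi h
  · have h' : 0 ≤ -x := by linarith
    have := sinLo_le h'
    push_cast at this ⊢
    rw [Real.sin_neg] at this
    linarith

/-! ### §2 `sin` on an interval `[lo, hi] ⊆ [−3, 3]` -/

/-- On `[lo, hi] ⊆ [−3, 3]` with `−π/2 ∉ (lo, hi)` guaranteed by `¬(lo < −157/100 ∧ −79/50 < hi)`: `sin x ≥ min (sin lo) (sin hi)`. [folklore] -/
theorem min_sin_le_sin {lo hi x : ℝ} (hlo : -3 ≤ lo) (hhi : hi ≤ 3) (h1 : lo ≤ x) (h2 : x ≤ hi)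
    (hc : ¬(lo < -157 / 100 ∧ -79 / 50 < hi)) : min (Real.sin lo) (Real.sin hi) ≤ Real.sin x := by
  have hπ1 := Real.pi_gt_d2
  have hπ2 := Real.pi_lt_d2
  rcases not_and_or.1 hc with hA | hB
  · -- lo ≥ -1.57 > -π/2
    have hlo' : -(π / 2) ≤ lo := by linarith
    by_cases hx : x ≤ π / 2
    · exact le_trans (min_le_left _ _) (Real.sin_le_sin_of_le_of_le_pi_div_two hlo' hx h1)
    · have hx' : π / 2 < x := not_le.1 hx
      have e1 : Real.sin x = Real.sin (π - x) := (Real.sin_pi_sub x).symm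
      have e2 : Real.sin hi = Real.sin (π - hi) := (Real.sin_pi_sub hi).symm
      have key : Real.sin (π - hi) ≤ Real.sin (π - x) :=
        Real.sin_le_sin_of_le_of_le_pi_div_two (by linarith) (by linarith) (by linarith)
      rw [← e1, ← e2] at key
      exact le_trans (min_le_right _ _) key
  · -- hi ≤ -1.58 < -π/2: sin decreasing on [-π, -π/2]
    have hhi' : hi ≤ -(π / 2) := by linarith
    have e1 : Real.sin x = -Real.sin (x + π) := by rw [Real.sin_add_pi]; ring
    have e2 : Real.sin hi = -Real.sin (hi + π) := by rw [Real.sin_add_pi]; ring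
    have key : Real.sin (x + π) ≤ Real.sin (hi + π) :=
      Real.sin_le_sin_of_le_of_le_pi_div_two (by linarith) (by linarith) (by linarith)
    rw [e1, e2]
    exact le_trans (min_le_right _ _) (by linarith)

/-- RANGE lower bound of `sin` on `[lo, hi]`: `−1` if `−π/2` may lie inside (`lo < −157/100 ∧ −79/50 < hi`), else the smaller endpoint bound. -/
def sinRLo (lo hi : ℚ) : ℚ := if lo < -157 / 100 ∧ -79 / 50 < hi then -1 else min (sinPtLo lo) (sinPtLo hi)

/-- RANGE upper bound of `sin` on `[lo, hi]` (by oddness from `sinRLo`). -/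
def sinRHi (lo hi : ℚ) : ℚ := -sinRLo (-hi) (-lo)

/-- `sinRLo lo hi ≤ sin x` for `x ∈ [lo, hi] ⊆ [−3, 3]`. [folklore] -/
theorem sinRLo_le {lo hi : ℚ} (hlo : -3 ≤ lo) (hhi : hi ≤ 3) {x : ℝ} (h1 : (lo : ℝ) ≤ x) (h2 : x ≤ (hi : ℝ)) :
    ((sinRLo lo hi : ℚ) : ℝ) ≤ Real.sin x := by
  unfold sinRLo
  split_ifs with hc
  · push_cast; exact Real.neg_one_le_sin x
  · have hc' : ¬((lo : ℝ) < -157 / 100 ∧ -79 / 50 < (hi : ℝ)) := by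
      intro h; apply hc; exact ⟨by exact_mod_cast h.1, by exact_mod_cast h.2⟩
    have m := min_sin_le_sin (by exact_mod_cast hlo) (by exact_mod_cast hhi) h1 h2 hc'
    have a := sinPtLo_le lo
    have b := sinPtLo_le hi
    push_cast
    exact le_trans (min_le_min a b) m

/-- `sin x ≤ sinRHi lo hi` for `x ∈ [lo, hi] ⊆ [−3, 3]`. [folklore] -/
theorem le_sinRHi {lo hi : ℚ} (hlo : -3 ≤ lo) (hhi : hi ≤ 3) {x : ℝ} (h1 : (lo : ℝ) ≤ x) (h2 : x ≤ (hi : ℝ)) :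
    Real.sin x ≤ ((sinRHi lo hi : ℚ) : ℝ) := by
  unfold sinRHi
  have h := sinRLo_le (lo := -hi) (hi := -lo) (by linarith) (by linarith) (x := -x)
    (by push_cast; linarith) (by push_cast; linarith)
  rw [Real.sin_neg] at h
  push_cast
  linarith

/-! ### §3 `cos` on an interval `[lo, hi] ⊆ [−3, 3]` -/

/-- RANGE lower bound of `cos` on `[lo, hi]`: `T₃(max |lo| |hi|)`. -/
def cosRLo (lo hi : ℚ) : ℚ := cosLo (max |lo| |hi|)

/-- RANGE upper bound of `cos` on `[lo, hi]`: `1` if `0 ∈ [lo, hi]`, else `T₂(min |lo| |hi|)`. -/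
def cosRHi (lo hi : ℚ) : ℚ := if lo ≤ 0 ∧ 0 ≤ hi then 1 else cosHi (min |lo| |hi|)

/-- `cosRLo lo hi ≤ cos x` for `x ∈ [lo, hi] ⊆ [−3, 3]`. [folklore] -/
theorem cosRLo_le {lo hi : ℚ} (hlo : -3 ≤ lo) (hhi : hi ≤ 3) {x : ℝ} (h1 : (lo : ℝ) ≤ x) (h2 : x ≤ (hi : ℝ)) :
    ((cosRLo lo hi : ℚ) : ℝ) ≤ Real.cos x := by
  have hπ1 := Real.pi_gt_d2
  have hlo' : (-3 : ℝ) ≤ (lo : ℝ) := by exact_mod_cast hlo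
  have hhi' : (hi : ℝ) ≤ 3 := by exact_mod_cast hhi
  unfold cosRLo
  set m : ℚ := max |lo| |hi| with hm
  have hxm : |x| ≤ (m : ℝ) := by
    rw [hm]; push_cast
    rcases le_or_gt 0 x with hx | hx
    · rw [abs_of_nonneg hx]
      exact le_trans (le_trans h2 (le_abs_self _)) (le_max_right _ _)
    · rw [abs_of_neg hx]
      have : -x ≤ |(lo : ℝ)| := by rw [abs_eq_max_neg]; exact le_trans (by linarith) (le_max_right _ _)
      exact le_trans this (le_max_left _ _)
  have hm3 : (m : ℝ) ≤ 3 := by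
    rw [hm]; push_cast
    exact max_le (abs_le.2 ⟨hlo', by linarith⟩) (abs_le.2 ⟨by linarith, hhi'⟩)
  have key : Real.cos m ≤ Real.cos |x| :=
    Real.cos_le_cos_of_nonneg_of_le_pi (abs_nonneg x) (by linarith) hxm
  rw [Real.cos_abs] at key
  exact le_trans (cosLo_le m) key

/-- `cos x ≤ cosRHi lo hi` for `x ∈ [lo, hi] ⊆ [−3, 3]`. [folklore] -/
theorem le_cosRHi {lo hi : ℚ} (hlo : -3 ≤ lo) (hhi : hi ≤ 3) {x : ℝ} (h1 : (lo : ℝ) ≤ x) (h2 : x ≤ (hi : ℝ)) :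
    Real.cos x ≤ ((cosRHi lo hi : ℚ) : ℝ) := by
  have hπ1 := Real.pi_gt_d2
  have hlo' : (-3 : ℝ) ≤ (lo : ℝ) := by exact_mod_cast hlo
  have hhi' : (hi : ℝ) ≤ 3 := by exact_mod_cast hhi
  unfold cosRHi
  split_ifs with hc
  · push_cast; exact Real.cos_le_one x
  · set m : ℚ := min |lo| |hi| with hm
    have hmx : (m : ℝ) ≤ |x| := by
      rw [hm]; push_cast
      rcases not_and_or.1 hc with hA | hB
      · have hA' : (0 : ℝ) < lo := by exact_mod_cast (not_le.1 hA)
        have hx : 0 < x := lt_of_lt_of_le hA' h1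
        rw [abs_of_pos hx]
        exact le_trans (min_le_left _ _) (by rw [abs_of_pos hA']; exact h1)
      · have hB' : (hi : ℝ) < 0 := by exact_mod_cast (not_le.1 hB)
        have hx : x < 0 := lt_of_le_of_lt h2 hB'
        rw [abs_of_neg hx]
        exact le_trans (min_le_right _ _) (by rw [abs_of_neg hB']; linarith)
    have hx3 : |x| ≤ 3 := abs_le.2 ⟨by linarith, by linarith⟩
    have hm0 : (0 : ℝ) ≤ (m : ℝ) := by rw [hm]; push_cast; exact le_min (abs_nonneg _) (abs_nonneg _)
    have key : Real.cos |x| ≤ Real.cos m :=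
      Real.cos_le_cos_of_nonneg_of_le_pi hm0 (by linarith) hmx
    rw [Real.cos_abs] at key
    exact le_trans key (le_cosHi m)

/-! ### §4 Sign-free product enclosure -/

/-- For `s ∈ [l, u]` and any real `c`: `min (c l) (c u) ≤ c s ≤ max (c l) (c u)`. [folklore] -/
theorem mul_mem_minmax (c : ℝ) {l u s : ℝ} (h1 : l ≤ s) (h2 : s ≤ u) :
    min (c * l) (c * u) ≤ c * s ∧ c * s ≤ max (c * l) (c * u) := by
  rcases le_or_gt 0 c with hc | hc
  · exact ⟨le_trans (min_le_left _ _) (mul_le_mul_of_nonneg_left h1 hc),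
      le_trans (mul_le_mul_of_nonneg_left h2 hc) (le_max_right _ _)⟩
  · exact ⟨le_trans (min_le_right _ _) (mul_le_mul_of_nonpos_left h2 hc.le),
      le_trans (mul_le_mul_of_nonpos_left h1 hc.le) (le_max_left _ _)⟩

/-- NAIVE enclosure of ONE coupling term `C sin d + D cos d` over `d ∈ [lo, hi]` (independent ranges of `sin`, `cos`): lower. -/
def naiveLo (C D lo hi : ℚ) : ℚ :=
  min (C * sinRLo lo hi) (C * sinRHi lo hi) + min (D * cosRLo lo hi) (D * cosRHi lo hi)

/-- NAIVE enclosure of ONE coupling term over `d ∈ [lo, hi]`: upper. -/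
def naiveHi (C D lo hi : ℚ) : ℚ :=
  max (C * sinRLo lo hi) (C * sinRHi lo hi) + max (D * cosRLo lo hi) (D * cosRHi lo hi)

/-- Naive term enclosure is sound on `[lo, hi] ⊆ [−3, 3]`. [folklore] -/
theorem naive_mem {C D lo hi : ℚ} (hlo : -3 ≤ lo) (hhi : hi ≤ 3) {d : ℝ} (h1 : (lo : ℝ) ≤ d) (h2 : d ≤ (hi : ℝ)) :
    ((naiveLo C D lo hi : ℚ) : ℝ) ≤ (C : ℝ) * Real.sin d + (D : ℝ) * Real.cos d ∧
      (C : ℝ) * Real.sin d + (D : ℝ) * Real.cos d ≤ ((naiveHi C D lo hi : ℚ) : ℝ) := by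
  have s := mul_mem_minmax (C : ℝ) (sinRLo_le hlo hhi h1 h2) (le_sinRHi hlo hhi h1 h2)
  have c := mul_mem_minmax (D : ℝ) (cosRLo_le hlo hhi h1 h2) (le_cosRHi hlo hhi h1 h2)
  unfold naiveLo naiveHi
  push_cast
  exact ⟨by linarith [s.1, c.1], by linarith [s.2, c.2]⟩

/-- POINTWISE enclosure of `C sin x + D cos x` at a rational `x`: lower. -/
def ptLo (C D x : ℚ) : ℚ := min (C * sinPtLo x) (C * sinPtHi x) + min (D * cosLo x) (D * cosHi x)

/-- POINTWISE enclosure of `C sin x + D cos x` at a rational `x`: upper. -/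
def ptHi (C D x : ℚ) : ℚ := max (C * sinPtLo x) (C * sinPtHi x) + max (D * cosLo x) (D * cosHi x)

/-- Pointwise term enclosure is sound. [folklore] -/
theorem pt_mem (C D x : ℚ) :
    ((ptLo C D x : ℚ) : ℝ) ≤ (C : ℝ) * Real.sin x + (D : ℝ) * Real.cos x ∧
      (C : ℝ) * Real.sin x + (D : ℝ) * Real.cos x ≤ ((ptHi C D x : ℚ) : ℝ) := by
  have s := mul_mem_minmax (C : ℝ) (sinPtLo_le x) (le_sinPtHi x)
  have c := mul_mem_minmax (D : ℝ) (cosLo_le x) (le_cosHi x)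
  unfold ptLo ptHi
  push_cast
  exact ⟨by linarith [s.1, c.1], by linarith [s.2, c.2]⟩

/-- Interval LOWER bound of the derivative `C cos m − D sin m` over `m ∈ [lo, hi]`. -/
def derivLo (C D lo hi : ℚ) : ℚ :=
  min (C * cosRLo lo hi) (C * cosRHi lo hi) - max (D * sinRLo lo hi) (D * sinRHi lo hi)

/-- Interval UPPER bound of the derivative `C cos m − D sin m` over `m ∈ [lo, hi]`. -/
def derivHi (C D lo hi : ℚ) : ℚ :=
  max (C * cosRLo lo hi) (C * cosRHi lo hi) - min (D * sinRLo lo hi) (D * sinRHi lo hi)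

/-- The trig identity behind the monotonicity test: `φ(y) − φ(x) = 2 sin((y−x)/2)·(C cos m − D sin m)`, `m = (y+x)/2`. -/
theorem term_sub_term (C D x y : ℝ) :
    (C * Real.sin y + D * Real.cos y) - (C * Real.sin x + D * Real.cos x) =
      2 * Real.sin ((y - x) / 2) * (C * Real.cos ((y + x) / 2) - D * Real.sin ((y + x) / 2)) := by
  have h1 : Real.sin y - Real.sin x = 2 * Real.sin ((y - x) / 2) * Real.cos ((y + x) / 2) := Real.sin_sub_sin y x
  have h2 : Real.cos y - Real.cos x = -2 * Real.sin ((y + x) / 2) * Real.sin ((y - x) / 2) := Real.cos_sub_cos y x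
  have e1 : (C * Real.sin y + D * Real.cos y) - (C * Real.sin x + D * Real.cos x) =
      C * (Real.sin y - Real.sin x) + D * (Real.cos y - Real.cos x) := by ring
  rw [e1, h1, h2]; ring

/-- MONOTONE case: `derivLo ≥ 0` on `[lo, hi] ⊆ [−3, 3]` ⇒ `φ = C sin + D cos` is monotone increasing there. [folklore] -/
theorem term_mono_of_derivLo {C D lo hi : ℚ} (hlo : -3 ≤ lo) (hhi : hi ≤ 3) (hd : 0 ≤ derivLo C D lo hi) {x y : ℝ}
    (hx : (lo : ℝ) ≤ x) (hxy : x ≤ y) (hy : y ≤ (hi : ℝ)) :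
    (C : ℝ) * Real.sin x + (D : ℝ) * Real.cos x ≤ (C : ℝ) * Real.sin y + (D : ℝ) * Real.cos y := by
  have hπ := Real.pi_gt_d2
  have hlo' : (-3 : ℝ) ≤ (lo : ℝ) := by exact_mod_cast hlo
  have hhi' : (hi : ℝ) ≤ 3 := by exact_mod_cast hhi
  have hm1 : (lo : ℝ) ≤ (y + x) / 2 := by linarith
  have hm2 : (y + x) / 2 ≤ (hi : ℝ) := by linarith
  have c := mul_mem_minmax (C : ℝ) (cosRLo_le hlo hhi hm1 hm2) (le_cosRHi hlo hhi hm1 hm2)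
  have s := mul_mem_minmax (D : ℝ) (sinRLo_le hlo hhi hm1 hm2) (le_sinRHi hlo hhi hm1 hm2)
  have hd' := (Rat.cast_le (K := ℝ)).2 hd
  simp only [derivLo] at hd'
  push_cast at hd'
  have hk : 0 ≤ (C : ℝ) * Real.cos ((y + x) / 2) - (D : ℝ) * Real.sin ((y + x) / 2) := by linarith [c.1, s.2]
  have hs : 0 ≤ Real.sin ((y - x) / 2) := Real.sin_nonneg_of_nonneg_of_le_pi (by linarith) (by linarith)
  have key := term_sub_term (C : ℝ) (D : ℝ) x y
  nlinarith [mul_nonneg hs hk, key]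

/-- ANTITONE case: `derivHi ≤ 0` on `[lo, hi] ⊆ [−3, 3]` ⇒ `φ = C sin + D cos` is monotone decreasing there. [folklore] -/
theorem term_anti_of_derivHi {C D lo hi : ℚ} (hlo : -3 ≤ lo) (hhi : hi ≤ 3) (hd : derivHi C D lo hi ≤ 0) {x y : ℝ}
    (hx : (lo : ℝ) ≤ x) (hxy : x ≤ y) (hy : y ≤ (hi : ℝ)) :
    (C : ℝ) * Real.sin y + (D : ℝ) * Real.cos y ≤ (C : ℝ) * Real.sin x + (D : ℝ) * Real.cos x := by
  have hπ := Real.pi_gt_d2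
  have hlo' : (-3 : ℝ) ≤ (lo : ℝ) := by exact_mod_cast hlo
  have hhi' : (hi : ℝ) ≤ 3 := by exact_mod_cast hhi
  have hm1 : (lo : ℝ) ≤ (y + x) / 2 := by linarith
  have hm2 : (y + x) / 2 ≤ (hi : ℝ) := by linarith
  have c := mul_mem_minmax (C : ℝ) (cosRLo_le hlo hhi hm1 hm2) (le_cosRHi hlo hhi hm1 hm2)
  have s := mul_mem_minmax (D : ℝ) (sinRLo_le hlo hhi hm1 hm2) (le_sinRHi hlo hhi hm1 hm2)
  have hd' := (Rat.cast_le (K := ℝ)).2 hd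
  simp only [derivHi] at hd'
  push_cast at hd'
  have hk : (C : ℝ) * Real.cos ((y + x) / 2) - (D : ℝ) * Real.sin ((y + x) / 2) ≤ 0 := by linarith [c.2, s.1]
  have hs : 0 ≤ Real.sin ((y - x) / 2) := Real.sin_nonneg_of_nonneg_of_le_pi (by linarith) (by linarith)
  have key := term_sub_term (C : ℝ) (D : ℝ) x y
  nlinarith [mul_nonpos_of_nonneg_of_nonpos hs hk, key]

/-- MONOTONICITY-AWARE enclosure of ONE coupling term `C sin d + D cos d` over `d ∈ [lo, hi]`: if the derivative test certifies
monotonicity, the range is attained at the ENDPOINTS (pointwise enclosures); else the naive enclosure. Lower value. -/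
def termLo (C D lo hi : ℚ) : ℚ :=
  if 0 ≤ derivLo C D lo hi then ptLo C D lo
  else if derivHi C D lo hi ≤ 0 then ptLo C D hi else naiveLo C D lo hi

/-- MONOTONICITY-AWARE enclosure of ONE coupling term over `d ∈ [lo, hi]`: upper value. -/
def termHi (C D lo hi : ℚ) : ℚ :=
  if 0 ≤ derivLo C D lo hi then ptHi C D hi
  else if derivHi C D lo hi ≤ 0 then ptHi C D lo else naiveHi C D lo hi

/-- **Term enclosure.** `d ∈ [lo, hi] ⊆ [−3, 3]` ⇒ `termLo ≤ C sin d + D cos d ≤ termHi`. [folklore] -/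
theorem term_mem {C D lo hi : ℚ} (hlo : -3 ≤ lo) (hhi : hi ≤ 3) {d : ℝ} (h1 : (lo : ℝ) ≤ d) (h2 : d ≤ (hi : ℝ)) :
    ((termLo C D lo hi : ℚ) : ℝ) ≤ (C : ℝ) * Real.sin d + (D : ℝ) * Real.cos d ∧
      (C : ℝ) * Real.sin d + (D : ℝ) * Real.cos d ≤ ((termHi C D lo hi : ℚ) : ℝ) := by
  have plo := pt_mem C D lo
  have phi := pt_mem C D hi
  have nv := naive_mem (C := C) (D := D) hlo hhi h1 h2
  unfold termLo termHi
  by_cases hA : 0 ≤ derivLo C D lo hi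
  · rw [if_pos hA, if_pos hA]
    have m1 := term_mono_of_derivLo hlo hhi hA le_rfl h1 h2
    have m2 := term_mono_of_derivLo hlo hhi hA h1 h2 le_rfl
    exact ⟨le_trans plo.1 m1, le_trans m2 phi.2⟩
  · rw [if_neg hA, if_neg hA]
    by_cases hB : derivHi C D lo hi ≤ 0
    · rw [if_pos hB, if_pos hB]
      have m1 := term_anti_of_derivHi hlo hhi hB h1 h2 le_rfl
      have m2 := term_anti_of_derivHi hlo hhi hB le_rfl h1 h2
      exact ⟨le_trans phi.1 m1, le_trans m2 plo.2⟩
    · rw [if_neg hB, if_neg hB]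
      exact nv

end SwingTube

end Summit.Ventures.GridStability.Models

end
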